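import Literature.Barriers.CriticalPhenomena.SupercriticalSAWSpaceFillingHoles
import HarnessLib

/-!
# Supercritical self-avoiding walks are space-filling (Duminil-Copin–Kozma–Yadin 2014):
# from a large hole to a touched box next to a large untouched connected family of deep boxes

Third file of the proof of Theorem 6 of H. Duminil-Copin, G. Kozma, A. Yadin, *Supercritical
self-avoiding walks are space-filling*, Ann. IHP Probab. Stat. 50 (2014) 315–326
(arXiv:1110.3074) for `Ω = 𝔻` (`DKY2014_thm6_disk`; objects and named facts in
`SupercriticalSAWSpaceFillingBoxes.lean`, the hole-box map in `…Holes.lean`). The printed proof: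
"there must exist a connected family of at least `s/(2m+1)²` boxes of size `2m+1` covering `S`
and not intersecting `γ_δ`. We may assume this family is maximal among families covering `S`
and not intersecting `γ_δ`. Since the family of boxes is maximal, and because of the condition
of the theorem that the family of all boxes is connected, the box-distance between the union of
boxes and `γ_δ` is 1." This file proves the deterministic geometric statement behind this
paragraph for the disk (the dichotomy itself is `good_or_bad_of_hasLargeHole` of
`…Dichotomy.lean`); this file supplies its ingredients:

* `exists_finset_of_hasLargeHole` — the component of `𝔻_δ ∖ Γ_δ^ξ` as a finite set `S ⊆ 𝔻_δ` of
  more than `s` sites at graph distance `≥ ξ` from the walk, chain-connected in `ℤ²`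
  (`familyStep`, `Relation.ReflTransGen`);
* the hole boxes `S.image (holeBox m)` are deep, untouched (`holeBox_untouched`), at least
  `#S/(7N)²` in number, and form a connected family (`isConnectedFamily_image_holeBox`);
* the family of deep boxes is connected through the origin: deepness is preserved by a step of
  the corner towards the origin (`IsDeep.sub_single`, `IsDeep.add_single`), so a property closed
  under deep neighbours propagates to all deep boxes (`forall_isDeep_of_closed`) — the printed
  "the family of all boxes in `𝔻_δ` is connected (it is an interval in every row and every
  column)".
-/

noncomputable section

open Literature.Probability.LatticeModels Literature.Probability.Percolation
  Literature.Probability.RandomPlanarGeometry.SAW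

namespace Literature.Barriers.CriticalPhenomena

namespace SupercriticalSAW

variable {δ : ℝ} {u v : Site 2}

/-! ### Chains of adjacent boxes inside a family -/

/-- The adjacency chain relation of a family `T` of sites of `ℤ²`: `ℤ²`-adjacent steps inside `T`.
[cite: DuminilCopinKozmaYadin2014, §3 (connected families of boxes)] -/
def familyStep (T : Finset (Site 2)) (x y : Site 2) : Prop :=
  (zdGraph 2).Adj x y ∧ x ∈ T ∧ y ∈ T

/-- A chain inside `T` gives reachability in the graph induced on `T`.
[cite: DuminilCopinKozmaYadin2014, §3 (connected families of boxes)] -/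
theorem reachable_induce_of_reflTransGen {T : Finset (Site 2)} {a b : Site 2} (ha : a ∈ T)
    (hb : b ∈ T) (h : Relation.ReflTransGen (familyStep T) a b) :
    ((zdGraph 2).induce (T : Set (Site 2))).Reachable ⟨a, ha⟩ ⟨b, hb⟩ := by
  induction h with
  | refl => rfl
  | tail _ hstep ih =>
    obtain ⟨hadj, hx, hy⟩ := hstep
    exact (ih hx).trans (SimpleGraph.Adj.reachable (SimpleGraph.induce_adj.2 hadj) : ((zdGraph 2).induce (T : Set (Site 2))).Reachable ⟨_, hx⟩ ⟨_, hy⟩)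

/-- Reachability in the graph induced on `T` gives a chain inside `T`.
[cite: DuminilCopinKozmaYadin2014, §3 (connected families of boxes)] -/
theorem reflTransGen_of_reachable_induce {T : Finset (Site 2)} {a b : ↥(T : Set (Site 2))}
    (h : ((zdGraph 2).induce (T : Set (Site 2))).Reachable a b) :
    Relation.ReflTransGen (familyStep T) a.1 b.1 := by
  obtain ⟨p⟩ := h
  induction p with
  | nil => exact Relation.ReflTransGen.refl
  | cons hadj _ ih =>
    exact Relation.ReflTransGen.head ⟨SimpleGraph.induce_adj.1 hadj, Subtype.property _,
      Subtype.property _⟩ ih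

/-- A connected family is chain-connected from any of its members.
[cite: DuminilCopinKozmaYadin2014, §3 (connected families of boxes)] -/
theorem IsConnectedFamily.reflTransGen {T : Finset (Site 2)} (hT : IsConnectedFamily T) {a b : Site 2}
    (ha : a ∈ T) (hb : b ∈ T) : Relation.ReflTransGen (familyStep T) a b :=
  reflTransGen_of_reachable_induce (hT ⟨a, ha⟩ ⟨b, hb⟩)

/-- Chains are monotone in the family. [folklore] -/
theorem familyStep_mono {T T' : Finset (Site 2)} (h : T ⊆ T') {a b : Site 2}
    (hab : Relation.ReflTransGen (familyStep T) a b) : Relation.ReflTransGen (familyStep T') a b :=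
  by
  induction hab with
  | refl => exact Relation.ReflTransGen.refl
  | tail _ h' ih => exact ih.tail ⟨h'.1, h h'.2.1, h h'.2.2⟩

/-! ### From a large hole to a large connected family of untouched deep boxes -/

/-- **The hole as a finite set of sites.** A component of `𝔻_δ ∖ Γ_δ^ξ` with more than `s`
sites gives a finite set `S ⊆ 𝔻_δ` of more than `s` sites, each at graph distance `≥ ξ` from
every vertex of the walk, and chain-connected in `ℤ²`.
[cite: DuminilCopinKozmaYadin2014, §3 (proof of Theorem 6: "the event 𝒜(s) that there exists a connected set S of cardinality s at distance larger than 6m of γ_δ")] -/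
theorem exists_finset_of_hasLargeHole (hδ : 0 < δ) {ξ s : ℝ}
    {γ : DomainSAW unitDisk δ u v} (h : HasLargeHole ξ s γ) :
    ∃ S : Finset (Site 2), s < S.card ∧ (∀ w ∈ S, w ∈ meshDomain unitDisk δ) ∧
      (∀ w ∈ S, ∀ t ∈ γ.walk.support, ξ ≤ ((discreteDomainGraph unitDisk δ).dist t w : ℝ)) ∧
      ∀ w ∈ S, ∀ w' ∈ S, Relation.ReflTransGen (familyStep S) w w' := by
  classical
  obtain ⟨C, hC⟩ := h
  have hfinV : (meshDomain unitDisk δ \ tube ξ γ).Finite :=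
    (meshDomain_finite (Metric.isBounded_ball) hδ).subset Set.sdiff_subset
  haveI : Finite ↥(meshDomain unitDisk δ \ tube ξ γ) := hfinV.to_subtype
  have hfin : (Subtype.val '' C.supp : Set (Site 2)).Finite := Set.toFinite _
  refine ⟨hfin.toFinset, ?_, ?_, ?_, ?_⟩
  · rw [← Set.ncard_eq_toFinset_card _ hfin, Set.ncard_image_of_injective _ Subtype.val_injective]
    exact hC
  · intro w hw
    rw [Set.Finite.mem_toFinset] at hw
    obtain ⟨x, -, rfl⟩ := hw
    exact x.2.1
  · intro w hw t ht
    rw [Set.Finite.mem_toFinset] at hw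
    obtain ⟨x, -, rfl⟩ := hw
    have hx := x.2.2
    simp only [tube, Set.mem_setOf_eq, not_and, not_exists] at hx
    exact not_lt.1 (hx x.2.1 t ht)
  · intro w hw w' hw'
    rw [Set.Finite.mem_toFinset] at hw hw'
    obtain ⟨x, hx, rfl⟩ := hw
    obtain ⟨y, hy, rfl⟩ := hw'
    rw [SimpleGraph.ConnectedComponent.mem_supp_iff] at hx hy
    obtain ⟨p⟩ := SimpleGraph.ConnectedComponent.exact (hx.trans hy.symm)
    -- walk induction inside the component
    clear hy
    induction p with
    | nil => exact Relation.ReflTransGen.refl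
    | @cons a b c hadj p ih =>
      have hb : (holeGraph ξ γ).connectedComponentMk b = C := by
        rw [← hx]; exact (SimpleGraph.ConnectedComponent.connectedComponentMk_eq_of_adj hadj).symm
      refine Relation.ReflTransGen.head ⟨?_, ?_, ?_⟩ (ih hb)
      · have := SimpleGraph.induce_adj.1 hadj
        exact (discreteDomainGraph_unitDisk_adj.1 this).1
      · rw [Set.Finite.mem_toFinset]; exact ⟨a, (SimpleGraph.ConnectedComponent.mem_supp_iff _ _).2 hx, rfl⟩
      · rw [Set.Finite.mem_toFinset]; exact ⟨b, (SimpleGraph.ConnectedComponent.mem_supp_iff _ _).2 hb, rfl⟩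


/-- The tube radius `ξ(m) = 6N + 2(2m+1) + 1` (`N = 2m+2`) used for Theorem 6 in the disk: one
more than the graph distance within which every site of a hole box lies from its site
(`dist_holeBox_le`). [cite: DuminilCopinKozmaYadin2014, Theorem 6 (Γ_δ^{6m})] -/
def tubeRadius (m : ℕ) : ℕ := 2 * (3 * (2 * m + 2)) + 2 * (2 * m + 1) + 1

/-- **Hole boxes are untouched**: if every site of `S ⊆ 𝔻_δ` is at graph distance `≥ ξ(m)` from
the walk and the hole boxes of `S` lie in `𝔻_δ`, then no vertex of the walk lies in a hole box
of `S`. [cite: DuminilCopinKozmaYadin2014, §3 (proof of Theorem 6: "Every box intersecting S must be disjoint from γ_δ")] -/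
theorem holeBox_untouched {m : ℕ} {γ : DomainSAW unitDisk δ u v} {S : Finset (Site 2)}
    (hS : ∀ w ∈ S, w ∈ meshDomain unitDisk δ)
    (hfar : ∀ w ∈ S, ∀ t ∈ γ.walk.support,
      (tubeRadius m : ℝ) ≤ ((discreteDomainGraph unitDisk δ).dist t w : ℝ))
    (hdeep : ∀ w ∈ S, IsDeep δ m (holeBox m w)) :
    ∀ z ∈ S.image (holeBox m), ∀ t ∈ γ.walk.support, t ∉ mBox m z := by
  intro z hz t ht htz
  obtain ⟨w, hw, rfl⟩ := Finset.mem_image.1 hz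
  obtain ⟨-, hdist⟩ := dist_holeBox_le (hS w hw) (hdeep w hw).mBox_subset htz
  have h1 := hfar w hw t ht
  rw [SimpleGraph.dist_comm] at hdist
  have h2 : (((discreteDomainGraph unitDisk δ).dist t w : ℕ) : ℝ) ≤
      (2 * (3 * (2 * m + 2)) + 2 * (2 * m + 1) : ℕ) := by exact_mod_cast hdist
  have h3 : ((2 * (3 * (2 * m + 2)) + 2 * (2 * m + 1) : ℕ) : ℝ) < (tubeRadius m : ℝ) := by
    unfold tubeRadius; exact_mod_cast Nat.lt_succ_self _
  linarith

/-- **Hole boxes of a chain-connected set form a connected family.**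
[cite: DuminilCopinKozmaYadin2014, §3 (proof of Theorem 6: "a connected family of … boxes … covering S")] -/
theorem isConnectedFamily_image_holeBox {m : ℕ} {S : Finset (Site 2)}
    (hS : ∀ w ∈ S, ∀ w' ∈ S, Relation.ReflTransGen (familyStep S) w w') :
    IsConnectedFamily (S.image (holeBox m)) := by
  classical
  rintro ⟨z, hz⟩ ⟨z', hz'⟩
  obtain ⟨w, hw, rfl⟩ := Finset.mem_image.1 hz
  obtain ⟨w', hw', rfl⟩ := Finset.mem_image.1 hz'
  have chain := hS w hw w' hw'
  -- along the chain the hole boxes are equal or adjacent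
  have key : ∀ b, Relation.ReflTransGen (familyStep S) w b → ∀ (hb : holeBox m b ∈ S.image (holeBox m)),
      ((zdGraph 2).induce ((S.image (holeBox m) : Finset (Site 2)) : Set (Site 2))).Reachable
        ⟨holeBox m w, hz⟩ ⟨holeBox m b, hb⟩ := by
    intro b hb
    induction hb with
    | refl => intro _; rfl
    | @tail c d _ hcd ih =>
      intro hd
      have hc : holeBox m c ∈ S.image (holeBox m) := Finset.mem_image_of_mem _ hcd.2.1
      refine (ih hc).trans ?_
      rcases holeBox_adj_or_eq (m := m) hcd.1 with h | h
      · have : (⟨holeBox m c, hc⟩ : ↥((S.image (holeBox m) : Finset (Site 2)) : Set (Site 2))) =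
            ⟨holeBox m d, hd⟩ := Subtype.ext h
        rw [this]
      · exact SimpleGraph.Adj.reachable (SimpleGraph.induce_adj.2 h)
  exact key w' chain hz'

/-! ### Deep boxes: moving towards the origin keeps a box deep -/

/-- Moving the corner one step towards the origin in a positive coordinate keeps a box deep
(the family of deep boxes "is an interval in every row and every column" through the origin).
[cite: DuminilCopinKozmaYadin2014, §3 (proof of Theorem 1 given Theorem 6)] -/
theorem IsDeep.sub_single {m : ℕ} {z : Site 2} (h : IsDeep δ m z) {i : Fin 2} (hi : 0 < z i) :
    IsDeep δ m (z - Pi.single i 1) := by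
  intro c hc
  rw [mem_thickBox_iff] at hc
  -- replace the `i`-th coordinate of `c` by the top of the range of `thickBox m z`
  set c' : Site 2 := Function.update c i ((2 * (m : ℤ) + 2) * z i + (2 * m + 1) + 2 * (2 * m + 2))
    with hc'
  have hc'mem : c' ∈ thickBox m z := by
    intro j
    by_cases hj : j = i
    · subst hj
      simp only [hc', Function.update_self]
      constructor <;> nlinarith
    · have := hc j
      simp only [hc', Function.update_of_ne hj]
      simpa [Pi.sub_apply, Pi.single_apply, hj] using this
  refine mem_meshDomain_unitDisk_of_abs_le (h hc'mem) fun j => ?_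
  by_cases hj : j = i
  · subst hj
    have := hc j
    simp only [Pi.sub_apply, Pi.single_eq_same] at this
    simp only [hc', Function.update_self]
    have hA : (2 * (m : ℤ) + 2) ≤ (2 * (m : ℤ) + 2) * z j := by nlinarith
    generalize hAeq : (2 * (m : ℤ) + 2) * z j = A at *
    have h1 : (2 * (m : ℤ) + 2) * (z j - 1) = A - (2 * m + 2) := by rw [mul_sub, hAeq]; ring
    rw [h1] at this
    rw [abs_le, abs_of_nonneg (by linarith)]
    constructor <;> linarith
  · simp only [hc', Function.update_of_ne hj]; exact le_rfl

/-- Moving the corner one step towards the origin in a negative coordinate keeps a box deep.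
[cite: DuminilCopinKozmaYadin2014, §3 (proof of Theorem 1 given Theorem 6)] -/
theorem IsDeep.add_single {m : ℕ} {z : Site 2} (h : IsDeep δ m z) {i : Fin 2} (hi : z i < 0) :
    IsDeep δ m (z + Pi.single i 1) := by
  intro c hc
  rw [mem_thickBox_iff] at hc
  set c' : Site 2 := Function.update c i ((2 * (m : ℤ) + 2) * z i - 2 * (2 * m + 2)) with hc'
  have hc'mem : c' ∈ thickBox m z := by
    intro j
    by_cases hj : j = i
    · subst hj
      simp only [hc', Function.update_self]
      constructor <;> nlinarith
    · have := hc j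
      simp only [hc', Function.update_of_ne hj]
      simpa [Pi.add_apply, Pi.single_apply, hj] using this
  refine mem_meshDomain_unitDisk_of_abs_le (h hc'mem) fun j => ?_
  by_cases hj : j = i
  · subst hj
    have := hc j
    simp only [Pi.add_apply, Pi.single_eq_same] at this
    simp only [hc', Function.update_self]
    have hA : (2 * (m : ℤ) + 2) * z j ≤ -(2 * (m : ℤ) + 2) := by nlinarith
    generalize hAeq : (2 * (m : ℤ) + 2) * z j = A at *
    have h1 : (2 * (m : ℤ) + 2) * (z j + 1) = A + (2 * m + 2) := by rw [mul_add, hAeq]; ring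
    rw [h1] at this
    rw [abs_le, abs_of_nonpos (by linarith)]
    constructor <;> linarith
  · simp only [hc', Function.update_of_ne hj]; exact le_rfl

/-- `ℓ¹`-norm bookkeeping: a unit step towards the origin in a negative coordinate. [folklore] -/
theorem sum_natAbs_add_single (z : Site 2) {i : Fin 2} (hi : z i < 0) :
    ∑ j, ((z + Pi.single i 1 : Site 2) j).natAbs + 1 = ∑ j, (z j).natAbs := by
  rw [Fin.sum_univ_two, Fin.sum_univ_two]
  fin_cases i <;> simp at hi ⊢ <;> omega

/-- `ℓ¹`-norm bookkeeping: a unit step towards the origin in a positive coordinate. [folklore] -/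
theorem sum_natAbs_sub_single (z : Site 2) {i : Fin 2} (hi : 0 < z i) :
    ∑ j, ((z - Pi.single i 1 : Site 2) j).natAbs + 1 = ∑ j, (z j).natAbs := by
  rw [Fin.sum_univ_two, Fin.sum_univ_two]
  fin_cases i <;> simp at hi ⊢ <;> omega

/-- **The family of deep boxes is connected through the origin**: a property of sites closed
under passing to deep `ℤ²`-neighbours and holding at one deep box holds at every deep box.
[cite: DuminilCopinKozmaYadin2014, §3 (proof of Theorem 1 given Theorem 6: "the family of all boxes in 𝔻_δ is connected")] -/
theorem forall_isDeep_of_closed {m : ℕ} {P : Site 2 → Prop}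
    (hcl : ∀ z, P z → ∀ (i : Fin 2) (b : Bool), IsDeep δ m (z + dirVec i b) → P (z + dirVec i b))
    {z₀ : Site 2} (hP : P z₀) (hz₀ : IsDeep δ m z₀) : ∀ z, IsDeep δ m z → P z := by
  have hsingle_t : ∀ i : Fin 2, dirVec i true = Pi.single i 1 := fun i => by simp [dirVec]
  have hsingle_f : ∀ i : Fin 2, dirVec i false = -Pi.single i 1 := fun i => by
    simp [dirVec, Pi.single_neg]
  -- descend from `z₀` to the origin
  have h0 : P 0 := by
    suffices key : ∀ n : ℕ, ∀ z : Site 2, ∑ i, (z i).natAbs = n → IsDeep δ m z → P z → P 0 from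
      key _ z₀ rfl hz₀ hP
    intro n
    induction n with
    | zero =>
      intro z hn _ hPz
      have : z = 0 := by
        funext i; exact Int.natAbs_eq_zero.1 (Finset.sum_eq_zero_iff.1 hn i (Finset.mem_univ i))
      exact this ▸ hPz
    | succ n ih =>
      intro z hn hz hPz
      obtain ⟨i, hi⟩ : ∃ i : Fin 2, z i ≠ 0 := by
        by_contra hcon; push Not at hcon
        have : ∑ j, (z j).natAbs = 0 := Finset.sum_eq_zero fun j _ => by simp [hcon j]
        omega
      rcases lt_or_gt_of_ne hi with hneg | hpos
      · have hz' := hz.add_single hneg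
        have hP' : P (z + Pi.single i 1) := by rw [← hsingle_t]; exact hcl z hPz i true (hsingle_t i ▸ hz')
        refine ih _ ?_ hz' hP'
        have := sum_natAbs_add_single z hneg
        omega
      · have hz' := hz.sub_single hpos
        have hP' : P (z - Pi.single i 1) := by
          rw [sub_eq_add_neg, ← hsingle_f]; exact hcl z hPz i false (by rw [hsingle_f, ← sub_eq_add_neg]; exact hz')
        refine ih _ ?_ hz' hP'
        have := sum_natAbs_sub_single z hpos
        omega
  -- climb from the origin to any deep box
  suffices key : ∀ n : ℕ, ∀ z : Site 2, ∑ i, (z i).natAbs = n → IsDeep δ m z → P z from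
    fun z hz => key _ z rfl hz
  intro n
  induction n with
  | zero =>
    intro z hn _
    have : z = 0 := by
      funext i; exact Int.natAbs_eq_zero.1 (Finset.sum_eq_zero_iff.1 hn i (Finset.mem_univ i))
    exact this ▸ h0
  | succ n ih =>
    intro z hn hz
    obtain ⟨i, hi⟩ : ∃ i : Fin 2, z i ≠ 0 := by
      by_contra hcon; push Not at hcon
      have : ∑ j, (z j).natAbs = 0 := Finset.sum_eq_zero fun j _ => by simp [hcon j]
      omega
    rcases lt_or_gt_of_ne hi with hneg | hpos
    · have hz' := hz.add_single hneg
      have hn' : ∑ j, ((z + Pi.single i 1 : Site 2) j).natAbs = n := by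
        have := sum_natAbs_add_single z hneg
        omega
      have hP' := ih _ hn' hz'
      have := hcl _ hP' i false (by rw [hsingle_f]; simpa using hz)
      rw [hsingle_f] at this; simpa using this
    · have hz' := hz.sub_single hpos
      have hn' : ∑ j, ((z - Pi.single i 1 : Site 2) j).natAbs = n := by
        have := sum_natAbs_sub_single z hpos
        omega
      have hP' := ih _ hn' hz'
      have := hcl _ hP' i true (by rw [hsingle_t]; simpa using hz)
      rw [hsingle_t] at this; simpa using this


end SupercriticalSAW

end Literature.Barriers.CriticalPhenomena
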